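import Summits.NavierStokesRegularity.NavierStokesRegularity.Theses.HodographBetchov

/-!
# Crux `FastClassSqueeze` (stmt-NavierStokesRegularity-15832, route `HodographBetchov`) — the BC2 split
# `NoFastEnergyConcentration → FastGradientSerrinStarved → FastClassSqueeze`

Theorems-only file (no definitions, no named facts, no `sorry`). The crux `FastClassSqueeze` — along every
classical solution of unforced Navier–Stokes on `ℝ³ × [0,T)` that is Leray–Hopf from a rapidly decaying datum
there are a speed level `l > 0`, an exponent `q > 3/2` and a nonnegative min–max majorant `m` of the middle
strain eigenvalue on the fast class `F_l(t) = {x : |u(t,x)| > l}` with `∫₀ᵀ (∫_{F_l} m^q)^{2/(2q−3)} < ∞` — is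
cut into the two TYPED pieces of its registered birth skeleton (`Cruxes/FastClassSqueeze/Lines/birth.lean`,
stubs vetted 2026-08-17, probes stub → crux / stub → summit failed 4/4), both stated INLINE below as the
hypotheses of the assembly theorem (they become the route's leaves by `route edit --split`, this theorem being
the glue `--glue-by`):

* X₁ `NoFastEnergyConcentration` — NO ENERGY QUANTUM ESCAPES TO INFINITE SPEED: along every such flow and for
  every `ε > 0` there is a level `l > 0` with `∫_{|u(t)|>l} |u(t,x)|² dx ≤ ε` for all `t ∈ [0,T)` (the kinetic
  energy is uniformly integrable over speed classes up to the possibly singular time `T`). An ENERGY-LEVEL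
  statement: compatible with self-similar-rate (Type I) collapse, where the fast class of level `l` carries
  energy `O(l⁻¹)`; it excludes only an energy-carrying, strongly Type-II collapse onto the (compact, `ℋ¹`-null)
  top singular set.
* X₂ `FastGradientSerrinStarved` — IN AN ENERGY-STARVED FAST CLASS THE GRADIENT IS SERRIN-SQUEEZED: along every
  such flow, IF the energy is uniformly integrable over speed classes (conclusion of X₁ for this flow) THEN for
  some level `l > 0` and exponent `q > 3/2` the fast-class velocity GRADIENT lies in the Miller–Serrin class,
  `∫₀ᵀ (∫_{|u(t)|>l} ‖∇u(t,x)‖^q dx)^{2/(2q−3)} dt < ∞` (Beirão da Veiga's `∇u ∈ L^p_t L^q_x`, `2/p + 3/q = 2`,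
  demanded only on the fast class, `|F_l(t)| ≤ 2E₀/l²`).

The seam is not `exact ⟨h₁, h₂⟩` but it is short: X₂ is fed the conclusion of X₁ (modus ponens per flow), and
the gradient bound is turned into the crux's min–max clause by the kinematic lemma `split_plane_form_le_opNorm`
(the operator norm `‖∇u(t,x)‖` majorises the Rayleigh quotient of `∇u(t,x)` on every 2-plane, so `m := ‖∇u‖` is
an admissible nonnegative majorant at every point). `trivial_seam`: no (one real lemma), but thin — see the
STRATEGY-CENSUS for the (c)/(d) audit of the pieces.

References: E. Miller, Arch. Ration. Mech. Anal. 235 (2020) = arXiv:1710.05569, Thm. 1.1 [Miller2019];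
H. Beirão da Veiga, Chinese Ann. Math. Ser. B 16 (1995) 407–412 (gradient criterion `2/p + 3/q = 2`);
L. Caffarelli, A. Vasseur, DCDS-S 3 (2010) 409–427, §3 (De Giorgi truncations in speed)
[doi:10.3934/dcdss.2010.3.409].
-/

noncomputable section

-- the summit and its single sub-problem share the name (CONVENTIONS §1), as in every Theorems file
set_option linter.dupNamespace false

namespace Summit.NavierStokesRegularity.NavierStokesRegularity.Theorems.FastClassSqueeze.Split

open MeasureTheory Set

/-- **Kinematic realisation of the min–max clause.** For every continuous linear map `A` of `ℝ³` there is
an orthonormal pair `v, w` (the first two standard basis vectors) on whose span the quadratic form of `A` is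
bounded by the operator norm: `⟪A ξ, ξ⟫ ≤ ‖A‖ ‖ξ‖² = ‖A‖ (α² + β²)` for `ξ = α v + β w`. Hence `m := ‖∇u‖`
is an admissible majorant in `FastClassSqueeze` at every point. [folklore] -/
theorem split_plane_form_le_opNorm (A : EuclideanSpace ℝ (Fin 3) →L[ℝ] EuclideanSpace ℝ (Fin 3)) :
    ∃ v w : EuclideanSpace ℝ (Fin 3), ‖v‖ = 1 ∧ ‖w‖ = 1 ∧ inner ℝ v w = 0 ∧
      ∀ α β : ℝ, inner ℝ (A (α • v + β • w)) (α • v + β • w) ≤ ‖A‖ * (α ^ 2 + β ^ 2) := by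
  classical
  have hv : ‖(EuclideanSpace.basisFun (Fin 3) ℝ) 0‖ = 1 :=
    (EuclideanSpace.basisFun (Fin 3) ℝ).orthonormal.1 0
  have hw : ‖(EuclideanSpace.basisFun (Fin 3) ℝ) 1‖ = 1 :=
    (EuclideanSpace.basisFun (Fin 3) ℝ).orthonormal.1 1
  have hvw : inner ℝ ((EuclideanSpace.basisFun (Fin 3) ℝ) 0) ((EuclideanSpace.basisFun (Fin 3) ℝ) 1) = 0 :=
    (EuclideanSpace.basisFun (Fin 3) ℝ).orthonormal.2 (by decide)
  refine ⟨(EuclideanSpace.basisFun (Fin 3) ℝ) 0, (EuclideanSpace.basisFun (Fin 3) ℝ) 1, hv, hw, hvw, ?_⟩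
  intro α β
  have hnorm : ‖α • (EuclideanSpace.basisFun (Fin 3) ℝ) 0 + β • (EuclideanSpace.basisFun (Fin 3) ℝ) 1‖ ^ 2
      = α ^ 2 + β ^ 2 := by
    rw [norm_add_sq_real, real_inner_smul_left, real_inner_smul_right, hvw, norm_smul, norm_smul, hv, hw]
    simp [sq_abs]
  calc inner ℝ (A (α • (EuclideanSpace.basisFun (Fin 3) ℝ) 0 + β • (EuclideanSpace.basisFun (Fin 3) ℝ) 1))
          (α • (EuclideanSpace.basisFun (Fin 3) ℝ) 0 + β • (EuclideanSpace.basisFun (Fin 3) ℝ) 1)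
        ≤ ‖A (α • (EuclideanSpace.basisFun (Fin 3) ℝ) 0 + β • (EuclideanSpace.basisFun (Fin 3) ℝ) 1)‖ *
            ‖α • (EuclideanSpace.basisFun (Fin 3) ℝ) 0 + β • (EuclideanSpace.basisFun (Fin 3) ℝ) 1‖ :=
          real_inner_le_norm _ _
    _ ≤ (‖A‖ * ‖α • (EuclideanSpace.basisFun (Fin 3) ℝ) 0 + β • (EuclideanSpace.basisFun (Fin 3) ℝ) 1‖) *
            ‖α • (EuclideanSpace.basisFun (Fin 3) ℝ) 0 + β • (EuclideanSpace.basisFun (Fin 3) ℝ) 1‖ :=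
          mul_le_mul_of_nonneg_right (A.le_opNorm _) (norm_nonneg _)
    _ = ‖A‖ * ‖α • (EuclideanSpace.basisFun (Fin 3) ℝ) 0 + β • (EuclideanSpace.basisFun (Fin 3) ℝ) 1‖ ^ 2 := by
          ring
    _ = ‖A‖ * (α ^ 2 + β ^ 2) := by rw [hnorm]

/-- **The BC2 split of `FastClassSqueeze`: `NoFastEnergyConcentration → FastGradientSerrinStarved →
FastClassSqueeze`** (glue of `route edit --split FastClassSqueeze --into NoFastEnergyConcentration
FastGradientSerrinStarved`; both pieces stated inline, verbatim the registered stubs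
`stub_no_fast_energy_concentration` / `stub_fast_gradient_serrin_of_no_concentration` of
`Cruxes/FastClassSqueeze/Lines/birth.lean`). Proof: along a given flow feed X₁ (no energy quantum escapes to
infinite speed) into X₂ (conditional fast-class gradient Serrin bound) to obtain the level `l`, the exponent
`q` and the mixed-norm bound; take the majorant `m(t,x) := ‖fderiv ℝ (u t) x‖`, nonnegative, which realises the
min–max clause at every point by `split_plane_form_le_opNorm`. [cite: Miller2019, Thm 1.1] -/
theorem fastClassSqueeze_of_subs
    (hX₁ : ∀ (ν T : ℝ), 0 < ν → 0 < T →
      ∀ (u : ℝ → EuclideanSpace ℝ (Fin 3) → EuclideanSpace ℝ (Fin 3)) (p : ℝ → EuclideanSpace ℝ (Fin 3) → ℝ),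
      Literature.Analysis.FluidPDE.IsClassicalNSSolutionOn (Set.Ico 0 T) ν 0 u p →
      Literature.Analysis.FluidPDE.IsLerayHopfOn T ν 0 (u 0) u →
      Literature.Analysis.FluidPDE.HasRapidSpatialDecay (u 0) →
      ∀ ε : ℝ, 0 < ε → ∃ l : ℝ, 0 < l ∧ ∀ t ∈ Set.Ico 0 T,
        ∫⁻ x in {x : EuclideanSpace ℝ (Fin 3) | l < ‖u t x‖}, ‖u t x‖ₑ ^ 2 ≤ ENNReal.ofReal ε)
    (hX₂ : ∀ (ν T : ℝ), 0 < ν → 0 < T →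
      ∀ (u : ℝ → EuclideanSpace ℝ (Fin 3) → EuclideanSpace ℝ (Fin 3)) (p : ℝ → EuclideanSpace ℝ (Fin 3) → ℝ),
      Literature.Analysis.FluidPDE.IsClassicalNSSolutionOn (Set.Ico 0 T) ν 0 u p →
      Literature.Analysis.FluidPDE.IsLerayHopfOn T ν 0 (u 0) u →
      Literature.Analysis.FluidPDE.HasRapidSpatialDecay (u 0) →
      (∀ ε : ℝ, 0 < ε → ∃ l : ℝ, 0 < l ∧ ∀ t ∈ Set.Ico 0 T,
        ∫⁻ x in {x : EuclideanSpace ℝ (Fin 3) | l < ‖u t x‖}, ‖u t x‖ₑ ^ 2 ≤ ENNReal.ofReal ε) →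
      ∃ l : ℝ, 0 < l ∧ ∃ q : ℝ, 3 / 2 < q ∧
        ∫⁻ t in Set.Ioo 0 T,
          (∫⁻ x in {x : EuclideanSpace ℝ (Fin 3) | l < ‖u t x‖}, ENNReal.ofReal ‖fderiv ℝ (u t) x‖ ^ q)
            ^ (2 / (2 * q - 3)) < ⊤) :
    Summit.NavierStokesRegularity.NavierStokesRegularity.Theses.HodographBetchov.FastClassSqueeze := by
  intro ν T hν hT u p hcl hLH hdec
  obtain ⟨l, hl, q, hq, hint⟩ :=
    hX₂ ν T hν hT u p hcl hLH hdec (hX₁ ν T hν hT u p hcl hLH hdec)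
  refine ⟨l, hl, q, hq, fun t x => ‖fderiv ℝ (u t) x‖, fun t x => norm_nonneg _, ?_, ?_⟩
  · intro t _ x _
    exact split_plane_form_le_opNorm (fderiv ℝ (u t) x)
  · simpa using hint


/-- **The glue BY NAME** (route file rev ≥ 6 carries the pieces as leaves `NoFastEnergyConcentration`,
`FastGradientSerrinStarved`, stmt-18118 / stmt-18120): definitionally `fastClassSqueeze_of_subs`. -/
theorem fastClassSqueeze_of_pieces :
    Summit.NavierStokesRegularity.NavierStokesRegularity.Theses.HodographBetchov.NoFastEnergyConcentration →
    Summit.NavierStokesRegularity.NavierStokesRegularity.Theses.HodographBetchov.FastGradientSerrinStarved →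
    Summit.NavierStokesRegularity.NavierStokesRegularity.Theses.HodographBetchov.FastClassSqueeze :=
  fun h₁ h₂ => fastClassSqueeze_of_subs h₁ h₂

/-- **The glue ITEM `FastClassSqueezeOfSubs` (stmt-NavierStokesRegularity-18129) holds** — its statement is
literally `NoFastEnergyConcentration → FastGradientSerrinStarved → FastClassSqueeze`; a prover closes the item by
landing this file as `Theorems/HodographBetchovFastClassSqueezeSplit.lean`. [cite: Miller2019, Thm 1.1] -/
theorem fastClassSqueezeOfSubs_proof :
    Summit.NavierStokesRegularity.NavierStokesRegularity.Theses.HodographBetchov.FastClassSqueezeOfSubs :=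
  fastClassSqueeze_of_pieces

end Summit.NavierStokesRegularity.NavierStokesRegularity.Theorems.FastClassSqueeze.Split

end
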